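import Mathlib
import Literature.Computability.AlgebraicComplexity.EquivariantDC
import Literature.Computability.AlgebraicComplexity.GrenetEquivariant
import Literature.Computability.AlgebraicComplexity.LinSubst
import Summits.ValiantsHypothesis.ValiantsHypothesis.Theorems.SymPencilSymmetrizePermPairsDagSymmetricPencil
import Summits.ValiantsHypothesis.ValiantsHypothesis.Theorems.SymPencilSymmetrizePermPairsLeVerrierDag
import HarnessLib

/-!
# ValiantsHypothesis / SymPencil — crux `SymmetrizePermPairs` (stmt-ValiantsHypothesis-17793),
# stub `stub_induce`, step (C3): the symmetric `Γ_n`-equivariant pencil of a covariant family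

Helper layer for the OPEN stub `stub_induce` (merged-desk RULING #195, task (C3) of the memo
`NOTE-p7g11-17793-C3-equivariantGKKP-sizing.md`; ABP/DAG model, companions
`…DagSymmetricPencil.lean` (C3b) and `…LeVerrierDag.lean` (C3a)).

**Main result** (`exists_isSymm_isEquivariantDetRepr_of_covariant_family`).  Let
`B₀, …, B_{R-1}` (`R, m ≥ 1`) be `m × m` affine pencils over `ℂ[x_{jk} : j, k < n]` with the SAME
determinant `g` and COVARIANT under the row/column permutation pairs: for every `(π, ρ)` there
are a block permutation `τ` and permutations `P_i` with
`B_i(x_{π j, ρ k}) = (B_{τ i})_{P_i a, P_i b}` (simultaneous conjugation).  Then `g` has a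
SYMMETRIC affine pencil of size `2 R (m³ + m) + 3` which is `Γ_n`-equivariant
(`IsEquivariantDetRepr` for the closure of the permutation matrices `P_{π × ρ}` — VERBATIM the
line file's `permPairSubst n`).  Construction: Le Verrier DAG of the family `(-B_i)` (C3a) →
Grenet–Kaltofen–Koiran–Portier layout (C3b), determinant `± 2 R g` → rescale the source row and
column by `λ` with `λ² · (± 2 R) = 1` (C3d) → re-index to `Fin`, DAG automorphisms become
permutation-matrix lifts, `IsEquivariantDetRepr.of_generators` (C3c).

This is the SUM model for `stub_induce`: applied to the family of translates of an
`H`-permified pencil (`[A4]`/`(I1)` with permutation-type lifts) it outputs the symmetric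
`Γ_n`-equivariant pencil of `per_n` of size polynomial in `R · m`.  No new definitions, no named
facts.  Honest framing: helper layer for an OPEN stub of an OPEN crux; `VP ≠ VNP` is NOT proved.
-/

-- `Summit.ValiantsHypothesis.ValiantsHypothesis.…` is the tree's mandated single-conjunct layout
-- (Sub = Summit), so the duplicated namespace component is intended.
set_option linter.dupNamespace false

namespace Summit.ValiantsHypothesis.ValiantsHypothesis.Theorems.SymPencilSymmetrizePermPairs.Dag

open Matrix MvPolynomial Literature.Computability.AlgebraicComplexity

/-! ### Permutation matrices as lifts -/

/-- Constants-embedding a permutation matrix gives the permutation matrix. [folklore] -/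
theorem permMatrix_map_C {k : Type*} [CommRing k] {σ N : Type*} [DecidableEq N]
    (α : Equiv.Perm N) :
    (α.permMatrix k).map (C : k →+* MvPolynomial σ k) = α.permMatrix (MvPolynomial σ k) := by
  refine Matrix.ext fun i j => ?_
  simp only [Matrix.map_apply, Equiv.Perm.permMatrix, PEquiv.toMatrix_apply]
  split_ifs
  · exact map_one _
  · exact map_zero _

/-- A simultaneous row/column permutation of a square polynomial matrix is a `GL`-sandwich by a
(constant) permutation matrix: `A_{α a, α b} = P_α · A · P_α⁻¹`. [folklore] -/
theorem exists_gl_sandwich_eq_submatrix {k : Type*} [CommRing k] {σ : Type*} {N : ℕ}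
    (A : Matrix (Fin N) (Fin N) (MvPolynomial σ k)) (α : Equiv.Perm (Fin N)) :
    ∃ g : GL (Fin N) k, (g : Matrix (Fin N) (Fin N) k).map C * A *
      ((g⁻¹ : GL (Fin N) k) : Matrix (Fin N) (Fin N) k).map C = A.submatrix α α := by
  let g : GL (Fin N) k :=
    ⟨α.permMatrix k, α⁻¹.permMatrix k,
      by rw [← Matrix.permMatrix_mul, inv_mul_cancel, Matrix.permMatrix_one],
      by rw [← Matrix.permMatrix_mul, mul_inv_cancel, Matrix.permMatrix_one]⟩
  refine ⟨g, ?_⟩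
  rw [show ((g⁻¹ : GL (Fin N) k) : Matrix (Fin N) (Fin N) k) = α⁻¹.permMatrix k from rfl,
    show ((g : GL (Fin N) k) : Matrix (Fin N) (Fin N) k) = α.permMatrix k from rfl,
    permMatrix_map_C, permMatrix_map_C, Equiv.Perm.permMatrix, Equiv.Perm.permMatrix,
    PEquiv.toMatrix_toPEquiv_mul, PEquiv.mul_toMatrix_toPEquiv, Matrix.submatrix_submatrix]
  rfl

/-- The sandwich-with-transpose form used by the permified pencils of the line
(`P_α · A · P_αᵀ`, constants-embedded) is the simultaneous row/column permutation `A_{α a, α b}`.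
[folklore] -/
theorem permMatrix_mul_mul_transpose_eq_submatrix {k : Type*} [CommRing k] {σ : Type*} {N : Type*}
    [Fintype N] [DecidableEq N] (A : Matrix N N (MvPolynomial σ k)) (α : Equiv.Perm N) :
    (α.permMatrix k).map (C : k →+* MvPolynomial σ k) * A * ((α.permMatrix k)ᵀ).map C =
      A.submatrix α α := by
  rw [Matrix.transpose_map, permMatrix_map_C, Equiv.Perm.permMatrix, ← PEquiv.toMatrix_symm,
    ← Equiv.toPEquiv_symm, PEquiv.toMatrix_toPEquiv_mul, PEquiv.mul_toMatrix_toPEquiv,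
    Matrix.submatrix_submatrix, Equiv.symm_symm]
  rfl

/-! ### The main construction -/

/-- **(C3) The symmetric `Γ_n`-equivariant pencil of a covariant family.**  See the module
docstring.  For `R, m ≥ 1`, `m × m` affine pencils `B_i` of the same polynomial `g`, covariant
under every row/column permutation pair `(π, ρ)` through a block permutation and simultaneous
conjugations, there is a SYMMETRIC affine pencil `A` of `g` of size `≤ 2 R (m³ + m) + 3` which is
equivariant (exact `GL`-lifts, `IsEquivariantDetRepr`) for the closure of the permutation
matrices `P_{π × ρ}` (the line file's `permPairSubst n`, verbatim). [folklore] -/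
theorem exists_isSymm_isEquivariantDetRepr_of_covariant_family (n R m : ℕ) (hR : 1 ≤ R)
    (hm : 1 ≤ m) (g : MvPolynomial (Fin n × Fin n) ℂ)
    (B : Fin R → Matrix (Fin m) (Fin m) (MvPolynomial (Fin n × Fin n) ℂ))
    (hB : ∀ i, IsAffineDetRepr g (B i))
    (hcov : ∀ π ρ : Equiv.Perm (Fin n), ∃ (τ : Equiv.Perm (Fin R)) (P : Fin R → Equiv.Perm (Fin m)),
      ∀ i, (B i).map (rename fun jk : Fin n × Fin n => (π jk.1, ρ jk.2)) =
        (B (τ i)).submatrix (P i) (P i)) :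
    ∃ m' ≤ 2 * R * (m ^ 3 + m) + 3,
      ∃ A : Matrix (Fin m') (Fin m') (MvPolynomial (Fin n × Fin n) ℂ), A.IsSymm ∧
        IsEquivariantDetRepr
          (Subgroup.closure {γ : GL (Fin n × Fin n) ℂ | ∃ π ρ : Equiv.Perm (Fin n),
            (γ : Matrix (Fin n × Fin n) (Fin n × Fin n) ℂ) =
              Equiv.Perm.permMatrix ℂ (Equiv.prodCongr π ρ)}) g A := by
  classical
  -- the Le Verrier constants `κ_l = -1/(m-l)` and the DAG of the family `(-B_i)`
  obtain ⟨E, b, a, y, hgr, hrec, hval, hshE, hsha, hcovE⟩ :=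
    exists_leVerrierDag R m hm (fun i => -B i) (fun l => C (-1 / ((m - l : ℕ) : ℂ))) (by
      intro l hl
      rw [← map_natCast C, ← map_mul, ← map_one C, ← map_neg]
      congr 1
      have : ((m - l : ℕ) : ℂ) ≠ 0 := Nat.cast_ne_zero.2 (by omega)
      field_simp)
  simp only [neg_neg] at hval
  -- the vertex count
  have hcardV : Fintype.card (((Fin R × (Fin m × (Fin m × Fin m))) ⊕ (Fin R × Fin m)) ⊕ Unit) =
      R * (m ^ 3 + m) + 1 := card_leVerrierDag_vertices R m
  -- affineness of the weights
  have haffB : ∀ i j k, (B i j k).totalDegree ≤ 1 := fun i => (hB i).1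
  have hEaff : ∀ u v, (E u v).totalDegree ≤ 1 := by
    intro u v
    rcases hshE u v with h | h | ⟨i, j, k, h⟩ | ⟨l, i, j, k, h⟩
    · rw [h]; simp
    · rw [h]; simp
    · rw [h, Matrix.neg_apply, totalDegree_neg]; exact haffB i j k
    · rw [h, Matrix.neg_apply, mul_neg, totalDegree_neg]
      refine (totalDegree_mul _ _).trans ?_
      rw [totalDegree_C, zero_add]
      exact haffB i j k
  have haaff : ∀ v, (a v).totalDegree ≤ 1 := by
    intro v
    rcases hsha v with h | h <;> rw [h] <;> simp
  -- the GKKP pencil of the DAG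
  set Pm := Matrix.fromBlocks (0 : Matrix Unit Unit (MvPolynomial (Fin n × Fin n) ℂ))
      (Matrix.of fun _ => Sum.elim a (Pi.single (Sum.inr ()) 1))
      (Matrix.of fun uv (_ : Unit) => Sum.elim a (Pi.single (Sum.inr ()) 1) uv)
      (Matrix.fromBlocks 0 (1 - E)ᵀ (1 - E) 0) with hPm
  have hdetPm : Pm.det = C ((-1) ^ (R * (m ^ 3 + m)) * 2 * R : ℂ) * g := by
    rw [hPm, det_dagPencil E b hgr a (Sum.inr ()) y hrec, hval,
      Finset.sum_congr rfl fun i _ => (hB i).2, Finset.sum_const, Finset.card_univ, Fintype.card_fin,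
      nsmul_eq_mul, hcardV, map_mul, map_mul, map_pow, map_neg, map_one, map_natCast, map_ofNat]
    ring
  have hsymmPm : Pm.IsSymm := by rw [hPm]; exact dagPencil_isSymm E a (Sum.inr ())
  have haffPm : ∀ i j, (Pm i j).totalDegree ≤ 1 := by
    rw [hPm]; exact dagPencil_totalDegree_le E a (Sum.inr ()) hEaff haaff
  -- (C3d) rescaling of the source row and column
  have hc0 : ((-1) ^ (R * (m ^ 3 + m)) * 2 * R : ℂ) ≠ 0 := by
    have : (R : ℂ) ≠ 0 := Nat.cast_ne_zero.2 (by omega)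
    exact mul_ne_zero (mul_ne_zero (pow_ne_zero _ (by norm_num)) two_ne_zero) this
  obtain ⟨lam, hlam⟩ := IsAlgClosed.exists_eq_mul_self (((-1) ^ (R * (m ^ 3 + m)) * 2 * R : ℂ))⁻¹
  set d : Unit ⊕ ((((Fin R × (Fin m × (Fin m × Fin m))) ⊕ (Fin R × Fin m)) ⊕ Unit) ⊕
      (((Fin R × (Fin m × (Fin m × Fin m))) ⊕ (Fin R × Fin m)) ⊕ Unit)) → MvPolynomial (Fin n × Fin n) ℂ :=
    Sum.elim (fun _ => C lam) (fun _ => 1) with hd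
  set Pm' := Matrix.diagonal d * Pm * Matrix.diagonal d with hPm'
  have hdetD : (Matrix.diagonal d).det = C lam := by
    rw [det_diagonal, Fintype.prod_sum_type, Fintype.prod_sum_type]
    simp [hd]
  have hdetPm' : Pm'.det = g := by
    rw [hPm', det_mul, det_mul, hdetD, hdetPm]
    calc C lam * (C ((-1) ^ (R * (m ^ 3 + m)) * 2 * R : ℂ) * g) * C lam
        = C (lam * lam * ((-1) ^ (R * (m ^ 3 + m)) * 2 * R : ℂ)) * g := by
          simp only [map_mul]; ring
      _ = g := by rw [← hlam, inv_mul_cancel₀ hc0, map_one, one_mul]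
  have hsymmPm' : Pm'.IsSymm := by
    unfold Matrix.IsSymm
    rw [hPm', transpose_mul, transpose_mul, diagonal_transpose, hsymmPm.eq, ← Matrix.mul_assoc]
  have hdaff : ∀ w, (d w).totalDegree = 0 := by
    rintro (w | w) <;> simp [hd]
  have haffPm' : ∀ i j, (Pm' i j).totalDegree ≤ 1 := by
    intro i j
    rw [hPm', Matrix.mul_diagonal (M := Matrix.diagonal d * Pm), Matrix.diagonal_mul]
    refine (totalDegree_mul _ _).trans ?_
    rw [hdaff j, add_zero]
    refine (totalDegree_mul _ _).trans ?_
    rw [hdaff i, zero_add]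
    exact haffPm i j
  -- covariance of `Pm'` under `rename (π × ρ)`
  have hcovPm' : ∀ π ρ : Equiv.Perm (Fin n), ∃ Θ : Equiv.Perm (Unit ⊕ ((((Fin R × (Fin m × (Fin m × Fin m))) ⊕ (Fin R × Fin m)) ⊕ Unit) ⊕ (((Fin R × (Fin m × (Fin m × Fin m))) ⊕ (Fin R × Fin m)) ⊕ Unit))),
      Pm'.map (rename fun jk : Fin n × Fin n => (π jk.1, ρ jk.2)) = Pm'.submatrix Θ Θ := by
    intro π ρ
    obtain ⟨τ, P, hτP⟩ := hcov π ρ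
    set φ : MvPolynomial (Fin n × Fin n) ℂ →+* MvPolynomial (Fin n × Fin n) ℂ :=
      (rename fun jk : Fin n × Fin n => (π jk.1, ρ jk.2)).toRingHom with hφ
    have hφC : ∀ c : ℂ, φ (C c) = C c := fun c => by simp [hφ]
    obtain ⟨θ, hθt, hθE, hθa⟩ := hcovE φ τ P (fun l => hφC _) (by
      intro i j k
      have h := congr_fun (congr_fun (hτP i) j) k
      simp only [Matrix.map_apply, Matrix.submatrix_apply] at h
      simp [hφ, Matrix.neg_apply, h])
    refine ⟨Equiv.sumCongr (Equiv.refl Unit) (Equiv.sumCongr θ θ), ?_⟩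
    have hmapPm : Pm.map φ = Pm.submatrix (Sum.map id (Sum.map θ θ)) (Sum.map id (Sum.map θ θ)) := by
      rw [hPm]; exact dagPencil_map_eq_submatrix E a (Sum.inr ()) φ θ hθt hθE hθa
    have hmapD : (Matrix.diagonal d).map φ = Matrix.diagonal d := by
      rw [Matrix.diagonal_map (map_zero φ)]
      congr 1
      funext w
      rcases w with w | w <;> simp [hd, hφC]
    have hsubD : (Matrix.diagonal d).submatrix (Sum.map id (Sum.map θ θ)) (Sum.map id (Sum.map θ θ)) =
        Matrix.diagonal d := by
      rw [show (Sum.map id (Sum.map θ θ) : Unit ⊕ ((((Fin R × (Fin m × (Fin m × Fin m))) ⊕ (Fin R × Fin m)) ⊕ Unit) ⊕ (((Fin R × (Fin m × (Fin m × Fin m))) ⊕ (Fin R × Fin m)) ⊕ Unit)) → Unit ⊕ ((((Fin R × (Fin m × (Fin m × Fin m))) ⊕ (Fin R × Fin m)) ⊕ Unit) ⊕ (((Fin R × (Fin m × (Fin m × Fin m))) ⊕ (Fin R × Fin m)) ⊕ Unit))) =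
          ⇑(Equiv.sumCongr (Equiv.refl Unit) (Equiv.sumCongr θ θ)) from rfl,
        submatrix_diagonal_equiv]
      congr 1
      funext w
      rcases w with w | (w | w) <;> simp [hd]
    have hbij : Function.Bijective
        (Sum.map id (Sum.map θ θ) : Unit ⊕ ((((Fin R × (Fin m × (Fin m × Fin m))) ⊕ (Fin R × Fin m)) ⊕ Unit) ⊕ (((Fin R × (Fin m × (Fin m × Fin m))) ⊕ (Fin R × Fin m)) ⊕ Unit)) → Unit ⊕ ((((Fin R × (Fin m × (Fin m × Fin m))) ⊕ (Fin R × Fin m)) ⊕ Unit) ⊕ (((Fin R × (Fin m × (Fin m × Fin m))) ⊕ (Fin R × Fin m)) ⊕ Unit))) :=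
      (Equiv.sumCongr (Equiv.refl Unit) (Equiv.sumCongr θ θ)).bijective
    change Pm'.map φ = Pm'.submatrix (Sum.map id (Sum.map θ θ)) (Sum.map id (Sum.map θ θ))
    rw [hPm', Matrix.map_mul, Matrix.map_mul, hmapD, hmapPm,
      Matrix.submatrix_mul _ _ _ _ _ hbij, Matrix.submatrix_mul _ _ _ _ _ hbij, hsubD]
  -- re-index to `Fin`
  clear_value Pm' d Pm
  set e := Fintype.equivFin (Unit ⊕ ((((Fin R × (Fin m × (Fin m × Fin m))) ⊕ (Fin R × Fin m)) ⊕ Unit) ⊕ (((Fin R × (Fin m × (Fin m × Fin m))) ⊕ (Fin R × Fin m)) ⊕ Unit))) with he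
  have hcardW : Fintype.card (Unit ⊕ ((((Fin R × (Fin m × (Fin m × Fin m))) ⊕ (Fin R × Fin m)) ⊕ Unit) ⊕
      (((Fin R × (Fin m × (Fin m × Fin m))) ⊕ (Fin R × Fin m)) ⊕ Unit))) = 2 * R * (m ^ 3 + m) + 3 := by
    rw [Fintype.card_sum, Fintype.card_sum, hcardV, Fintype.card_unit]; ring
  refine ⟨_, hcardW.le, Matrix.reindex e e Pm', ?_, ?_⟩
  · -- symmetry
    unfold Matrix.IsSymm
    rw [Matrix.transpose_reindex, hsymmPm'.eq]
  · -- equivariance for the generators, then closure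
    refine IsEquivariantDetRepr.of_generators
      ⟨fun i j => haffPm' (e.symm i) (e.symm j), ?_⟩ ?_
    · rw [Matrix.det_reindex_self, hdetPm']
    · rintro γ ⟨π, ρ, hγ⟩
      -- `P_{π × ρ}` acts by `rename (π⁻¹ × ρ⁻¹)`
      obtain ⟨Θ, hΘ⟩ := hcovPm' π.symm ρ.symm
      have hfun : (⇑(Equiv.prodCongr π.symm ρ.symm) : Fin n × Fin n → Fin n × Fin n) =
          fun jk => (π.symm jk.1, ρ.symm jk.2) := by
        funext jk; cases jk; rfl
      have hlin : Matrix.linSubstEntries γ (Matrix.reindex e e Pm') =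
          (Matrix.reindex e e Pm').map
            (rename fun jk : Fin n × Fin n => (π.symm jk.1, ρ.symm jk.2)) := by
        rw [Matrix.linSubstEntries, hγ, linSubst_permMatrix, Equiv.prodCongr_symm, hfun]
      obtain ⟨g', hg'⟩ :=
        exists_gl_sandwich_eq_submatrix (Matrix.reindex e e Pm') ((e.symm.trans Θ).trans e)
      refine ⟨g', g', ?_⟩
      rw [hg', hlin]
      refine Matrix.ext fun i j => ?_
      have h := congr_fun (congr_fun hΘ (e.symm i)) (e.symm j)
      simp only [Matrix.map_apply, Matrix.submatrix_apply] at h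
      simp only [Matrix.map_apply, Matrix.reindex_apply, Matrix.submatrix_apply, Equiv.trans_apply,
        Equiv.symm_apply_apply, h]

end Summit.ValiantsHypothesis.ValiantsHypothesis.Theorems.SymPencilSymmetrizePermPairs.Dag
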